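import Literature.AlgebraicGeometry.Frobenioids.BaseSectionsOfObjects
import Literature.AlgebraicGeometry.Frobenioids.ElementaryIsos
import HarnessLib

/-!
# Frobenioids I, Proposition 5.6 / Corollary 5.7 (iii): the schemata `PairConjugate F u σ σ' φ φ'` and
# `MapsPair F₁ F₂ Ψ σ₁ φ₁ σ₂ φ₂ τ` (FACT-LIST F-0945 / F-0944) are RELATIONS ON DATA — their universal
# closures are refutable; their instance forms (reflexivity, symmetry, transitivity) are proved

Mochizuki, *The geometry of Frobenioids I: the general theory*, Kyushu J. Math. **62** (2008)
293–400, §5, Proposition 5.6 p. 105 ("… up to conjugation [as a pair!] by an element of `O^×(A)`")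
and Corollary 5.7 (iii) p. 108 ("`Ψ` maps every quasi-base-Frobenius pair of a Frobenius-trivial object
`A₁ ∈ Ob(C₁)` to a quasi-base-Frobenius pair of a Frobenius-trivial object `A₂ ∈ Ob(C₂)`")
[cite: MochizukiFrdI2008, Prop. 5.6 p.105] [cite: MochizukiFrdI2008, Cor. 5.7 (iii) p.108].

Negative knowledge and instance forms recorded next to `BaseSectionsOfObjects.lean` (abc-iut-L1,
p409201), PROOF-ONLY (no definition, no instance), abc-iut cell seat abc-iut-f-024 (block F, FACT-LIST
rows **F-0945** `PreFrobenioid.PairConjugate`, **F-0944** `PreFrobenioid.MapsPair`; class `preparatory`,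
kernel_closedness `parametrised`).

Both rows are PARAMETRISED predicates — the two RELATIONS in which Prop. 5.6 and Cor. 5.7 (iii) are
stated.  `PairConjugate F u σ σ' φ φ'` says "the pair `(σ', φ')` is the `u`-conjugate of `(σ, φ)`";
`MapsPair F₁ F₂ Ψ σ₁ φ₁ σ₂ φ₂ τ` says "`Ψ` carries `(σ₁, φ₁)` to `(σ₂, φ₂)` up to `τ ∈ Aut(ℕ_{≥1})`".  In
the tree they occur ONLY inside conclusions (`Prop56`: `∃ u ∈ O^×(A), PairConjugate F u σ σ' φ φ'`;
`Cor57iii` / `Cor57iv`: `∃ σ₂ φ₂ τ, … ∧ MapsPair …`), never as a hypothesis.  Binding either at FREE data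
is not a statement of the paper, and the UNIVERSAL closures ("any two pairs are conjugate by any unit",
"any pair over `Ψ(A₁)` is the image of any pair over `A₁`") are false.  This file supplies the kernel
objects at the smallest data ([FrdI] Def. 1.1 (iii)): the one-object elementary Frobenioid
`F_{Φ_𝟙} = ElemFrobenioid (constMonoidOn PUnit)` over the base `𝟙 = Discrete PUnit`, its unique object
`⋆`, the TRIVIAL homomorphism `ℕ_{≥1} → End(⋆)` versus the Frobenius section
`ζ_⋆ : n ↦ (id, 0, n)` (`ElemFrobenioid.frobeniusSection`, Prop. 1.5), which differ in Frobenius degree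
at `n = 2`:

* `not_pairConjugate_one_frobeniusSection` / `not_forall_pairConjugate` (F-0945);
* `not_mapsPair_one_frobeniusSection` / `not_forall_mapsPair` (F-0944).

INSTANCE forms (what the relations are FOR) are PROVED for every pre-Frobenioid structure functor `F`:
`pairConjugate_refl` (`u = 1`), `PairConjugate.symm` (`u ↦ u⁻¹`), `PairConjugate.trans` (`u, u' ↦ u u'`),
`exists_mem_unitsSubgroup_pairConjugate_self` (the `∃ u ∈ O^×(A)` form of Prop. 5.6's conclusion, at
`(σ', φ') = (σ, φ)`), and `mapsPair_refl` (Cor. 5.7 (iii)'s conclusion shape at `Ψ = 𝟭`, `τ = id`);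
(v2) `MapsPair.trans` — "maps pairs to pairs" composes along `Ψ ≫ Ψ'` with `τ ≫ τ'`.  The
printed claims themselves remain the named statements `PreFrobenioid.Prop56` (proved in the tree in the
generality of the author's 2024 Comment (2): `BaseSectionsOfObjectsUniquenessGeneral.lean`) and
`PreFrobenioid.Cor57iii` (`BaseSectionsOfObjectsCor57bProofs.lean`).  So each row is admissible ONLY
as vocabulary (FACT-LIST class «universal-closure REFUTED / schema; instance forms PROVED»).
Elementary category theory; nothing here bears on the disputed [IUTchIII] Cor. 3.12 or takes a side;
refuted-as-schema is a statement about OUR typing, not about the paper.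
-/

namespace Literature.AlgebraicGeometry.Frobenioids

namespace PreFrobenioid

open CategoryTheory

universe w v v' u u'

/-! ### Instance forms: conjugacy of pairs is reflexive, symmetric, transitive -/

section InstanceForms

variable {D : Type u} [Category.{v} D] {Φ : Dᵒᵖ ⥤ CommMonCat.{w}}
  {C : Type u'} [Category.{v'} C] (F : C ⥤ ElemFrobenioid Φ)

/-- **F-0945, instance form (reflexivity):** every pair `(σ, φ)` is conjugate to itself by the unit
`1 ∈ O^×(A)`. [cite: MochizukiFrdI2008, Prop. 5.6 p.105] -/
theorem pairConjugate_refl {A : C} (σ : Aut (baseObj F A) →* Aut A) (φ : ℕ+ →* End A) :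
    PairConjugate F (Iso.refl A) σ σ φ φ := by
  refine ⟨fun α => ?_, fun n => ?_⟩
  · simp only [Iso.refl_symm, Iso.refl_trans, Iso.trans_refl]
  · show End.asHom (φ n) = 𝟙 A ≫ End.asHom (φ n) ≫ 𝟙 A
    rw [Category.id_comp, Category.comp_id]

/-- **F-0945, instance form (the `∃ u ∈ O^×(A)` shape of Prop. 5.6's conclusion at `(σ', φ') = (σ, φ)`):**
witnessed by `u = 1`. [cite: MochizukiFrdI2008, Prop. 5.6 p.105] -/
theorem exists_mem_unitsSubgroup_pairConjugate_self {A : C} (σ : Aut (baseObj F A) →* Aut A)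
    (φ : ℕ+ →* End A) : ∃ u ∈ unitsSubgroup F A, PairConjugate F u σ σ φ φ :=
  ⟨Iso.refl A, (unitsSubgroup F A).one_mem, pairConjugate_refl F σ φ⟩

variable {F}

/-- **F-0945, instance form (symmetry):** if `(σ', φ')` is the `u`-conjugate of `(σ, φ)`, then `(σ, φ)`
is the `u⁻¹`-conjugate of `(σ', φ')`. [cite: MochizukiFrdI2008, Prop. 5.6 p.105] -/
theorem PairConjugate.symm {A : C} {u : Aut A} {σ σ' : Aut (baseObj F A) →* Aut A}
    {φ φ' : ℕ+ →* End A} (h : PairConjugate F u σ σ' φ φ') : PairConjugate F u.symm σ' σ φ' φ := by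
  obtain ⟨hσ, hφ⟩ := h
  refine ⟨fun α => ?_, fun n => ?_⟩
  · simp only [hσ α, Iso.symm_symm_eq, Iso.trans_assoc, Iso.self_symm_id_assoc, Iso.self_symm_id,
      Iso.trans_refl]
  · show End.asHom (φ n) = u.hom ≫ End.asHom (φ' n) ≫ u.inv
    rw [show End.asHom (φ' n) = u.inv ≫ End.asHom (φ n) ≫ u.hom from hφ n, Category.assoc,
      Category.assoc, Iso.hom_inv_id, Category.comp_id, Iso.hom_inv_id_assoc]

/-- **F-0945, instance form (transitivity):** conjugating by `u` and then by `u'` is conjugating by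
`u u'` (diagrammatic `u ≪≫ u'`). [cite: MochizukiFrdI2008, Prop. 5.6 p.105] -/
theorem PairConjugate.trans {A : C} {u u' : Aut A} {σ σ' σ'' : Aut (baseObj F A) →* Aut A}
    {φ φ' φ'' : ℕ+ →* End A} (h : PairConjugate F u σ σ' φ φ') (h' : PairConjugate F u' σ' σ'' φ' φ'') :
    PairConjugate F (u ≪≫ u') σ σ'' φ φ'' := by
  obtain ⟨hσ, hφ⟩ := h
  obtain ⟨hσ', hφ'⟩ := h'
  refine ⟨fun α => ?_, fun n => ?_⟩
  · simp only [hσ' α, hσ α, Iso.trans_symm, Iso.trans_assoc]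
  · show End.asHom (φ'' n) = (u'.inv ≫ u.inv) ≫ End.asHom (φ n) ≫ u.hom ≫ u'.hom
    rw [show End.asHom (φ'' n) = u'.inv ≫ End.asHom (φ' n) ≫ u'.hom from hφ' n,
      show End.asHom (φ' n) = u.inv ≫ End.asHom (φ n) ≫ u.hom from hφ n, Category.assoc,
      Category.assoc, Category.assoc]

variable (F)

/-- **F-0944, instance form:** the identity equivalence carries every pair `(σ, φ)` at `A` to itself,
with `τ = id` — the shape of Cor. 5.7 (iii)/(iv)'s conclusion at `Ψ = 𝟭`. [cite: MochizukiFrdI2008,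
Cor. 5.7 (iii) p.108] -/
theorem mapsPair_refl {A : C} (σ : Aut (baseObj F A) →* Aut A) (φ : ℕ+ →* End A) :
    MapsPair F F (CategoryTheory.Equivalence.refl (C := C)) σ φ σ φ (MulEquiv.refl ℕ+) := by
  refine ⟨fun α => ⟨α, Iso.ext rfl⟩, fun β => ⟨β, Iso.ext rfl⟩, fun n => rfl⟩

end InstanceForms

/-! ### The witnesses against the universal closures

Throughout, the base is `𝟙 = Discrete PUnit` with the trivial divisor monoid `Φ_𝟙 := constMonoidOn PUnit`
([FrdI] Def. 1.1 (iii)), the pre-Frobenioid structure functor is the identity of `F_{Φ_𝟙}`, the object is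
`⋆ := ElemFrobenioid.of Φ_𝟙 ⟨⋆⟩`, all sections `σ` and the unit `u` are trivial, and the two Frobenius
homomorphisms compared are `1 : ℕ_{≥1} → End(⋆)` and `ζ_⋆ = ElemFrobenioid.frobeniusSection ⋆`. -/

section Witnesses

/-- The Frobenius section `ζ_⋆(2) = (id, 0, 2)` is not the identity of `⋆` (Frobenius degree `2 ≠ 1`).
[cite: MochizukiFrdI2008, Prop. 1.5 p.27] -/
theorem frobeniusSection_two_ne_one :
    ElemFrobenioid.frobeniusSection
        (ElemFrobenioid.of (constMonoidOn PUnit.{1}) (Discrete.mk PUnit.unit)) 2 ≠ 1 := by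
  intro h
  have h2 : (2 : ℕ+) = 1 := congrArg ElemFrobenioid.Hom.degFr h
  exact absurd h2 (by decide)

/-- **F-0945, universal closure false:** at `⋆ ∈ F_{Φ_𝟙}` with `u = 1`, `σ = σ' = 1`, the pair with
Frobenius part `φ = 1` is NOT conjugate to the pair with Frobenius part `φ' = ζ_⋆`
(`ζ_⋆(2) ≠ 1 = 1⁻¹ ∘ 1 ∘ 1`). [cite: MochizukiFrdI2008, Prop. 5.6 p.105] -/
theorem not_pairConjugate_one_frobeniusSection :
    ¬ PairConjugate (𝟭 (ElemFrobenioid (constMonoidOn PUnit.{1})))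
        (Iso.refl (ElemFrobenioid.of (constMonoidOn PUnit.{1}) (Discrete.mk PUnit.unit))) 1 1 1
        (ElemFrobenioid.frobeniusSection
          (ElemFrobenioid.of (constMonoidOn PUnit.{1}) (Discrete.mk PUnit.unit))) := by
  rintro ⟨-, hφ⟩
  refine frobeniusSection_two_ne_one ?_
  have h2 := hφ 2
  rw [MonoidHom.one_apply, Iso.refl_inv, Iso.refl_hom] at h2
  rw [h2]
  show 𝟙 _ ≫ 𝟙 _ ≫ 𝟙 _ = 𝟙 _
  rw [Category.id_comp, Category.id_comp]

/-- **F-0945 as a schema is not a fact:** the fully quantified closure of `PreFrobenioid.PairConjugate`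
(over all bases, divisor monoids, structure functors, objects, units and pairs, at universe level `0`)
is FALSE.  The printed claim is the named statement `PreFrobenioid.Prop56` (`∃ u ∈ O^×(A), …` for
RESTRICTED pairs). [cite: MochizukiFrdI2008, Prop. 5.6 p.105] -/
theorem not_forall_pairConjugate :
    ¬ ∀ {D : Type} [Category.{0} D] {Φ : Dᵒᵖ ⥤ CommMonCat.{0}} {C : Type} [Category.{0} C]
        (F : C ⥤ ElemFrobenioid Φ) {A : C} (u : Aut A) (σ σ' : Aut (baseObj F A) →* Aut A)
        (φ φ' : ℕ+ →* End A), PairConjugate F u σ σ' φ φ' :=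
  fun h => not_pairConjugate_one_frobeniusSection (h _ _ _ _ _ _)

/-- **F-0944, universal closure false:** at `⋆ ∈ F_{Φ_𝟙}`, `Ψ = 𝟭`, `τ = id`, `σ₁ = σ₂ = 1`, the pair
with Frobenius part `φ₁ = 1` is NOT carried to the pair with Frobenius part `φ₂ = ζ_⋆`
(`Ψ(φ₁(2)) = 1 ≠ ζ_⋆(2)`). [cite: MochizukiFrdI2008, Cor. 5.7 (iii) p.108] -/
theorem not_mapsPair_one_frobeniusSection :
    ¬ MapsPair (𝟭 (ElemFrobenioid (constMonoidOn PUnit.{1})))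
        (𝟭 (ElemFrobenioid (constMonoidOn PUnit.{1}))) CategoryTheory.Equivalence.refl
        (A₁ := ElemFrobenioid.of (constMonoidOn PUnit.{1}) (Discrete.mk PUnit.unit)) 1 1 1
        (ElemFrobenioid.frobeniusSection
          (ElemFrobenioid.of (constMonoidOn PUnit.{1}) (Discrete.mk PUnit.unit)))
        (MulEquiv.refl ℕ+) := by
  rintro ⟨-, -, hφ⟩
  refine frobeniusSection_two_ne_one ?_
  have h2 := hφ 2
  rw [MonoidHom.one_apply, MulEquiv.refl_apply] at h2
  exact h2.symm

/-- **F-0944 as a schema is not a fact:** the fully quantified closure of `PreFrobenioid.MapsPair`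
(over all bases, divisor monoids, structure functors, equivalences `Ψ`, objects, pairs and `τ`, at
universe level `0`) is FALSE.  The printed claim is the named statement `PreFrobenioid.Cor57iii`
(`∃ σ₂ φ₂ τ, … ∧ MapsPair …`). [cite: MochizukiFrdI2008, Cor. 5.7 (iii) p.108] -/
theorem not_forall_mapsPair :
    ¬ ∀ {D₁ : Type} [Category.{0} D₁] {Φ₁ : D₁ᵒᵖ ⥤ CommMonCat.{0}} {C₁ : Type} [Category.{0} C₁]
        (F₁ : C₁ ⥤ ElemFrobenioid Φ₁)
        {D₂ : Type} [Category.{0} D₂] {Φ₂ : D₂ᵒᵖ ⥤ CommMonCat.{0}} {C₂ : Type} [Category.{0} C₂]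
        (F₂ : C₂ ⥤ ElemFrobenioid Φ₂) (Ψ : C₁ ≌ C₂) {A₁ : C₁}
        (σ₁ : Aut (baseObj F₁ A₁) →* Aut A₁) (φ₁ : ℕ+ →* End A₁)
        (σ₂ : Aut (baseObj F₂ (Ψ.functor.obj A₁)) →* Aut (Ψ.functor.obj A₁))
        (φ₂ : ℕ+ →* End (Ψ.functor.obj A₁)) (τ : ℕ+ ≃* ℕ+), MapsPair F₁ F₂ Ψ σ₁ φ₁ σ₂ φ₂ τ :=
  fun h => not_mapsPair_one_frobeniusSection (h _ _ _ _ _ _ _ _)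

end Witnesses

/-! ### Instance form (v2 append): "`Ψ` maps pairs to pairs" composes along equivalences -/

section MapsPairTrans

variable {D₁ : Type u} [Category.{v} D₁] {Φ₁ : D₁ᵒᵖ ⥤ CommMonCat.{w}}
  {C₁ : Type u'} [Category.{v'} C₁] (F₁ : C₁ ⥤ ElemFrobenioid Φ₁)
  {D₂ : Type u} [Category.{v} D₂] {Φ₂ : D₂ᵒᵖ ⥤ CommMonCat.{w}}
  {C₂ : Type u'} [Category.{v'} C₂] (F₂ : C₂ ⥤ ElemFrobenioid Φ₂)
  {D₃ : Type u} [Category.{v} D₃] {Φ₃ : D₃ᵒᵖ ⥤ CommMonCat.{w}}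
  {C₃ : Type u'} [Category.{v'} C₃] (F₃ : C₃ ⥤ ElemFrobenioid Φ₃)

/-- **F-0944, instance form (transitivity):** if `Ψ` carries `(σ₁, φ₁)` at `A₁` to `(σ₂, φ₂)` at `Ψ(A₁)`
up to `τ`, and `Ψ'` carries `(σ₂, φ₂)` to `(σ₃, φ₃)` at `Ψ'(Ψ(A₁))` up to `τ'`, then the composite
equivalence `Ψ ≫ Ψ'` carries `(σ₁, φ₁)` to `(σ₃, φ₃)` up to `τ ≫ τ'` — the structural law by which
Cor. 5.7 (iii) for `Ψ` and for `Ψ'` yields Cor. 5.7 (iii) for `Ψ ≫ Ψ'` (together with `mapsPair_refl`: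
the relation is a "functorial" one). [cite: MochizukiFrdI2008, Cor. 5.7 (iii) p.108] -/
theorem MapsPair.trans {Ψ : C₁ ≌ C₂} {Ψ' : C₂ ≌ C₃} {A₁ : C₁}
    {σ₁ : Aut (baseObj F₁ A₁) →* Aut A₁} {φ₁ : ℕ+ →* End A₁}
    {σ₂ : Aut (baseObj F₂ (Ψ.functor.obj A₁)) →* Aut (Ψ.functor.obj A₁)}
    {φ₂ : ℕ+ →* End (Ψ.functor.obj A₁)}
    {σ₃ : Aut (baseObj F₃ (Ψ'.functor.obj (Ψ.functor.obj A₁))) →*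
      Aut (Ψ'.functor.obj (Ψ.functor.obj A₁))}
    {φ₃ : ℕ+ →* End (Ψ'.functor.obj (Ψ.functor.obj A₁))} {τ τ' : ℕ+ ≃* ℕ+}
    (h : MapsPair F₁ F₂ Ψ σ₁ φ₁ σ₂ φ₂ τ) (h' : MapsPair F₂ F₃ Ψ' σ₂ φ₂ σ₃ φ₃ τ') :
    MapsPair F₁ F₃ (Ψ.trans Ψ') σ₁ φ₁ σ₃ φ₃ (τ.trans τ') := by
  obtain ⟨h₁, h₂, h₃⟩ := h
  obtain ⟨h₁', h₂', h₃'⟩ := h'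
  refine ⟨fun α => ?_, fun γ => ?_, fun n => ?_⟩
  · obtain ⟨β, hβ⟩ := h₁ α
    obtain ⟨γ, hγ⟩ := h₁' β
    exact ⟨γ, hγ.trans ((congrArg (fun i => Ψ'.functor.mapIso i) hβ).trans (Iso.ext rfl))⟩
  · obtain ⟨β, hβ⟩ := h₂' γ
    obtain ⟨α, hα⟩ := h₂ β
    exact ⟨α, hβ.trans ((congrArg (fun i => Ψ'.functor.mapIso i) hα).trans (Iso.ext rfl))⟩
  · show Ψ'.functor.map (Ψ.functor.map (φ₁ n)) = φ₃ (τ' (τ n))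
    rw [h₃ n, h₃' (τ n)]

end MapsPairTrans

end PreFrobenioid

end Literature.AlgebraicGeometry.Frobenioids
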